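import Mathlib
import HarnessLib
import Summits.QuantumFields.YangMills.Theorems.SelfNormalisedSkewness.Negative.TreeLevelSkewnessVanishes
import Summits.QuantumFields.YangMills.Theorems.SkewnessNonGeneration.Negative.MassiveGaussianFoil

/-!
# `SqueezedFactorisation` (stmt-QuantumFields-25917, route `SqueezedSkewness`, leaf `BalabanLadder.NT` = rung R2a) —
# BC5 rung α: the ONE-LOOP OPE MODEL of the squeezed three-point function factorises onto the mirror
# two-point insertion with `σ = -1`, `w = κ·(shell moment)`, explicit `δ(ρ/ℓ) < 1`, uniformly in the mirror

R3 / RECORD framing: nothing here proves `SqueezedFactorisation`, `NT`, or any Yang–Mills / mass-gap statement.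
This file is the tribunal-w (bc5-witness) deliverable for the deciding crux X2 of `route-QuantumFields-SqueezedSkewness`
(judge ym-trib-j-1, round 1: T3 ABSENT ⇒ "rung (α) one-loop truncation of the squeezed factorisation (β₀ coefficient;
sign-definite; no decay in the mirror distance)").  It decides the crux's inequality in the CARICATURE that the route's
own thesis names (Theses/SqueezedSkewness.lean, WHY THIS LINE and NOT DECOMPOSED YET), and records the tree-level fact
that makes one loop the leading order.

**The model (one-loop OPE truncation).**  In the squeeze regime `ρ ≪ ℓ_h ≪ d_mirror` the route replaces the connected
three-point function `Q3(v, θv, h)` of the action density by its operator-product form in the scalar channel: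
`T3(v, A, h) = ∫ v(x) · (∫ h(z) c(z - x) dz) · A(x) dx`, where `A(x)` is the mirror insertion (`= ∫ θv(y) ⟨[G²](x)[G²](y)⟩ dy`,
non-negative for non-negative `θv` and a pointwise non-negative two-point kernel — its form never matters below) and
`c(u)` is the separated-point scalar fusion coefficient of `dens × dens → [dens]`.  AT TREE LEVEL `c ≡ 0` away from
`u = 0`: the single-contraction term of `:F²:(x) :F²:(z)` projected on the local scalar `:F²:(x)` has coefficient
`Σ_(μν) G_(μν),(μν)(u) = tr G(u)`, and `tr G(u) = tr K(∇∇|u|⁻²) = -3·Δ|u|⁻² = 0` (`traceK_eq_zero_of_traceless` below with the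
landed `hessInvSq_trace` of `Theorems/SelfNormalisedSkewness/Negative/`; this is the statement "C₁^GG is pure contact at tree level", Zoller–Chetyrkin arXiv:1209.1516
eq. (19): `C₁^(0) = -1`·δ).  AT ONE LOOP the separated-point coefficient is the scheme-independent logarithm
`Q²∂C₁^GG/∂Q² = a_s β₀ + O(a_s²)`, `β₀ = 11 C_A/12 > 0` (arXiv:1209.1516 eq. (20), "unambiguous"), i.e. in position space
`c(u) = -κ/‖u‖⁴` with `κ = κ′(ℓ) = (b₀/2π²)·ḡ⁴(ℓ) > 0`, `b₀ = 11N/(48π²)` for `SU(N)` (crux idea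
`Cruxes/NT/Ideas/skewness-from-asymptotic-freedom.md` §4; sign in the tree's convention `dens = Σ Re tr U_p`).  The model
takes exactly this kernel, with `κ > 0` a parameter (the sign-definiteness of β₀ is the INPUT `0 < κ`; its derivation from
the Yang–Mills Feynman rules is not formalised here).

**What is proved (sorry-free).**
* `traceK_eq_zero_of_traceless` (with the landed `MassiveGaussianFoil.trace_K`: `tr K(H) = -3 tr H`) — `tr K(H) = 0` for traceless `H`: the tree-level scalar fusion kernel
  `tr maxwellKernel u = tr K(hessInvSq u)` of the free Maxwell square vanishes at every point (so `treeLevelModel_eq_zero`: the tree-level model three-point functional is identically `0`; one loop is the leading order —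
  the positive-order companion of the negative calibration `maxwellRing3_eq_zero`).
* `norm_sub_shell_bounds`, `integrable_shellKernel`, `shellMoment_bounds` — bump–shell geometry: for `‖x - c‖ ≤ ρ ≤ t·ℓ` and
  `h` supported in `ℓ ≤ ‖z - c‖` (any centre `c`; the route's is `c = e₀ = EuclideanSpace.single 0 1`), the smeared kernel
  `W(x) = ∫ h(z)‖z - x‖⁻⁴ dz` is pinched between `(1+t)⁻⁴·W(c)` and `(1-t)⁻⁴·W(c)`.
* `oneLoopModel_squeezedFactorisation` — for non-negative continuous `v` (support in `closedBall c ρ`), `h` (support in the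
  shell), `κ > 0` and EVERY non-negative continuous mirror insertion `A`:
  `|T3(v, A, h) - (-1)·w·T2(v, A)| ≤ δ(t)·w·T2(v, A)` with `T2(v, A) = ∫ v·A`, `w = κ·W(c)` (κ times the shell moment
  `∫ h(z)‖z - c‖⁻⁴ dz`) and `δ(t) = (1-t)⁻⁴ - (1+t)⁻⁴`.
* `oneLoopModel_cruxShape` — the crux's literal conclusion shape `∃ w δ σ, 0 < w ∧ δ < 1 ∧ (σ = 1 ∨ σ = -1) ∧ …` for
  `ρ ≤ ℓ/16`, with the quantifier over the mirror insertion `A` INSIDE the existential: the constants do not depend on the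
  mirror (no decay in the mirror distance — the two-point insertion carries all of it), `σ = -1`, `δ = (16/15)⁴ - (16/17)⁴ < 1`.
* `oneLoopModel_neg` — sign-definiteness: `T3 < 0` whenever `T2 > 0`.

**Why this is a witness for X2 and not for the leaf.**  X2 (`SqueezedFactorisation`) asserts precisely this inequality
for the lattice Yang–Mills cumulants `Q3, Q2` of `Theorems/LangevinControlUVOSLegsFromFemtoAndGapDefs.lean`, conditioned
on clause-(i) floors; the leaf `NT` asks for ONE triple with `|Q3| ≥ ε`, not a factorisation, and is silent about the
squeeze; the model is decided here while its NT-analogue is not a statement about the model at all.  What separates the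
model from X2 is exactly the route's XL stub `stub_squeezeOnShells` (lattice OPE of `dens × dens` at scale `ℓ_h/a` with a
β- and volume-uniform relative remainder, RG-improved coefficient `κ′(ℓ)`): order-by-order perturbative existence of the
OPE for gauge-invariant composites in Euclidean YM₄ is Fröb–Holland arXiv:1603.08012 Thm 1; nothing uniform is in print
(barrier `Literature/Barriers/QuantumFields/PerturbativeInvisibility.lean` for the magnitude — the route inherits the
magnitude from clause (i), only the RATIO is perturbative).  The numerical instrument row `R(ℓ_h; d_mirror)` (one-loop
lattice PT / SU(2) Monte-Carlo) named by the judge is NOT run here (kit closed to this seat) and is requested from the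
ladder director.
-/

namespace Summit.QuantumFields.YangMills.Theorems.SqueezedSkewness

open MeasureTheory Metric Function
open Summit.QuantumFields.YangMills.Theorems.SelfNormalisedSkewness.Negative

/-! ## 0. Tree level: the scalar fusion kernel of the free Maxwell square vanishes pointwise -/

/-- **Tree-level scalar fusion coefficient = 0 at separated points.** `tr K(H) = 0` for every traceless `H`; with
`H = hessInvSq u = ∇∇|u|⁻²` (traceless: `hessInvSq_trace`, harmonicity of `|u|⁻²` in `d = 4`) this is `tr G(u) = 0` for the
free Maxwell field-strength covariance `G = maxwellKernel u = K (hessInvSq u)`: the coefficient of the local scalar `:F²:(x)`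
in the single-contraction term of `:F²:(x)·:F²:(x+u)`, i.e. the separated-point part of `C₁^GG` at tree level, vanishes
(Zoller–Chetyrkin: `C₁^(0)` is pure contact). [cite: ZollerChetyrkin2012, eq. (19)] -/
theorem traceK_eq_zero_of_traceless (H : Matrix (Fin 4) (Fin 4) ℝ) (hH : H.trace = 0) : (K H).trace = 0 := by
  rw [Summit.QuantumFields.YangMills.Theorems.SkewnessNonGeneration.Negative.MassiveGaussianFoil.trace_K, hH, mul_zero]

/-- Hence the TREE-LEVEL model of the squeezed three-point functional (scalar channel, fusion kernel `u ↦ tr K(H u)` for a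
traceless Hessian field `H`, e.g. `H = hessInvSq`, kernel `tr maxwellKernel`) is identically zero, for every bump `v`,
shell `h` and mirror insertion `A`: one loop is the leading order. [folklore] -/
theorem treeLevelModel_eq_zero (H : EuclideanSpace ℝ (Fin 4) → Matrix (Fin 4) (Fin 4) ℝ) (hH : ∀ u, (H u).trace = 0)
    (v h A : EuclideanSpace ℝ (Fin 4) → ℝ) :
    (∫ x, v x * (∫ z, h z * (K (H (z - x))).trace) * A x) = 0 := by
  simp [traceK_eq_zero_of_traceless _ (hH _)]

/-! ## 1. Bump–shell geometry -/

/-- For `x` in the bump (`‖x - c‖ ≤ ρ ≤ t·ℓ`) and `z` in the shell (`ℓ ≤ ‖z - c‖`):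
`(1-t)‖z - c‖ ≤ ‖z - x‖ ≤ (1+t)‖z - c‖`. [folklore] -/
theorem norm_sub_shell_bounds {c x z : EuclideanSpace ℝ (Fin 4)} {ρ ℓ t : ℝ} (ht : 0 ≤ t) (hρt : ρ ≤ t * ℓ)
    (hx : ‖x - c‖ ≤ ρ) (hz : ℓ ≤ ‖z - c‖) :
    (1 - t) * ‖z - c‖ ≤ ‖z - x‖ ∧ ‖z - x‖ ≤ (1 + t) * ‖z - c‖ := by
  have hzx : z - x = (z - c) - (x - c) := (sub_sub_sub_cancel_right z x c).symm
  have hxt : ‖x - c‖ ≤ t * ‖z - c‖ :=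
    hx.trans (hρt.trans (mul_le_mul_of_nonneg_left hz ht))
  constructor
  · have h1 : ‖z - c‖ - ‖x - c‖ ≤ ‖z - x‖ := by rw [hzx]; exact norm_sub_norm_le _ _
    linarith
  · have h2 : ‖z - x‖ ≤ ‖z - c‖ + ‖x - c‖ := by rw [hzx]; exact norm_sub_le _ _
    linarith

/-- The smeared one-loop kernel `z ↦ h(z)‖z - x‖⁻⁴` is integrable as soon as the (continuous, compactly supported) shell
profile `h` stays at distance `m > 0` from `x`. [folklore] -/
theorem integrable_shellKernel {h : EuclideanSpace ℝ (Fin 4) → ℝ} (hc : Continuous h) (hcs : HasCompactSupport h) {x : EuclideanSpace ℝ (Fin 4)} {m : ℝ}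
    (hm : 0 < m) (hsep : ∀ z, h z ≠ 0 → m ≤ ‖z - x‖) :
    Integrable (fun z => h z * (‖z - x‖ ^ 4)⁻¹) := by
  have hi : Integrable h := hc.integrable_of_hasCompactSupport hcs
  refine (hi.norm.mul_const ((m ^ 4)⁻¹)).mono' ?_ (Filter.Eventually.of_forall fun z => ?_)
  · exact (hc.measurable.mul ((continuous_id.sub continuous_const).norm.pow 4).measurable.inv).aestronglyMeasurable
  · rw [norm_mul, norm_inv, norm_pow, norm_norm]
    by_cases h0 : h z = 0
    · simp [h0]
    · have hmz : m ≤ ‖z - x‖ := hsep z h0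
      have hp : m ^ 4 ≤ ‖z - x‖ ^ 4 := pow_le_pow_left₀ hm.le hmz 4
      exact mul_le_mul_of_nonneg_left (inv_anti₀ (pow_pos hm 4) hp) (norm_nonneg _)

/-- **Shell-moment pinching.** For `x` in the bump and a non-negative shell profile `h` (support in `ℓ ≤ ‖z - c‖`), the
smeared one-loop kernel `W(x) = ∫ h(z)‖z - x‖⁻⁴ dz` lies between `(1+t)⁻⁴·W(c)` and `(1-t)⁻⁴·W(c)`. [folklore] -/
theorem shellMoment_bounds {c : EuclideanSpace ℝ (Fin 4)} {h : EuclideanSpace ℝ (Fin 4) → ℝ} (hc : Continuous h) (hcs : HasCompactSupport h) (h0 : ∀ z, 0 ≤ h z)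
    {ρ ℓ t : ℝ} (hℓ : 0 < ℓ) (ht0 : 0 ≤ t) (ht1 : t < 1) (hρt : ρ ≤ t * ℓ)
    (hshell : ∀ z, h z ≠ 0 → ℓ ≤ ‖z - c‖) {x : EuclideanSpace ℝ (Fin 4)} (hx : ‖x - c‖ ≤ ρ) :
    ((1 + t) ^ 4)⁻¹ * (∫ z, h z * (‖z - c‖ ^ 4)⁻¹) ≤ (∫ z, h z * (‖z - x‖ ^ 4)⁻¹) ∧
    (∫ z, h z * (‖z - x‖ ^ 4)⁻¹) ≤ ((1 - t) ^ 4)⁻¹ * ∫ z, h z * (‖z - c‖ ^ 4)⁻¹ := by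
  have h1t : 0 < 1 - t := by linarith
  have hIx : Integrable (fun z => h z * (‖z - x‖ ^ 4)⁻¹) := by
    refine integrable_shellKernel hc hcs (mul_pos h1t hℓ) fun z hz => ?_
    have hze : ℓ ≤ ‖z - c‖ := hshell z hz
    exact le_trans (mul_le_mul_of_nonneg_left hze h1t.le) (norm_sub_shell_bounds ht0 hρt hx hze).1
  have hI0 : Integrable (fun z => h z * (‖z - c‖ ^ 4)⁻¹) :=
    integrable_shellKernel hc hcs hℓ (fun z hz => by simpa using hshell z hz)
  have key : ∀ z, h z ≠ 0 →
      ((1 + t) ^ 4)⁻¹ * (‖z - c‖ ^ 4)⁻¹ ≤ (‖z - x‖ ^ 4)⁻¹ ∧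
      (‖z - x‖ ^ 4)⁻¹ ≤ ((1 - t) ^ 4)⁻¹ * (‖z - c‖ ^ 4)⁻¹ := by
    intro z hz
    have hze : ℓ ≤ ‖z - c‖ := hshell z hz
    have hze0 : 0 < ‖z - c‖ := hℓ.trans_le hze
    obtain ⟨hlo, hhi⟩ := norm_sub_shell_bounds ht0 hρt hx hze
    have hzx0 : 0 < ‖z - x‖ := lt_of_lt_of_le (mul_pos h1t hze0) hlo
    refine ⟨?_, ?_⟩
    · rw [← mul_inv, ← mul_pow]
      exact inv_anti₀ (pow_pos hzx0 4) (pow_le_pow_left₀ (norm_nonneg _) hhi 4)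
    · rw [← mul_inv, ← mul_pow]
      exact inv_anti₀ (pow_pos (mul_pos h1t hze0) 4) (pow_le_pow_left₀ (mul_pos h1t hze0).le hlo 4)
  refine ⟨?_, ?_⟩
  · rw [← integral_const_mul]
    refine integral_mono_of_nonneg (Filter.Eventually.of_forall fun z => ?_) hIx
      (Filter.Eventually.of_forall fun z => ?_)
    · exact mul_nonneg (inv_nonneg.2 (pow_nonneg (by linarith) 4))
        (mul_nonneg (h0 z) (inv_nonneg.2 (pow_nonneg (norm_nonneg _) 4)))
    · by_cases hz : h z = 0
      · simp [hz]
      · calc ((1 + t) ^ 4)⁻¹ * (h z * (‖z - c‖ ^ 4)⁻¹)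
            = h z * (((1 + t) ^ 4)⁻¹ * (‖z - c‖ ^ 4)⁻¹) := by ring
          _ ≤ h z * (‖z - x‖ ^ 4)⁻¹ := mul_le_mul_of_nonneg_left (key z hz).1 (h0 z)
  · rw [← integral_const_mul]
    refine integral_mono_of_nonneg (Filter.Eventually.of_forall fun z => ?_) (hI0.const_mul _)
      (Filter.Eventually.of_forall fun z => ?_)
    · exact mul_nonneg (h0 z) (inv_nonneg.2 (pow_nonneg (norm_nonneg _) 4))
    · by_cases hz : h z = 0
      · simp [hz]
      · calc h z * (‖z - x‖ ^ 4)⁻¹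
            ≤ h z * (((1 - t) ^ 4)⁻¹ * (‖z - c‖ ^ 4)⁻¹) := mul_le_mul_of_nonneg_left (key z hz).2 (h0 z)
          _ = ((1 - t) ^ 4)⁻¹ * (h z * (‖z - c‖ ^ 4)⁻¹) := by ring

/-- The shell moment `W(c) = ∫ h(z)‖z - c‖⁻⁴ dz` of a non-negative, non-zero, compactly supported shell profile is
positive. [folklore] -/
theorem shellMoment_pos {c : EuclideanSpace ℝ (Fin 4)} {h : EuclideanSpace ℝ (Fin 4) → ℝ} (hc : Continuous h) (h0 : ∀ z, 0 ≤ h z) {ℓ R : ℝ} (hℓ : 0 < ℓ)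
    (hshell : ∀ z, h z ≠ 0 → ℓ ≤ ‖z - c‖) (hR : tsupport h ⊆ closedBall c R) {z₀ : EuclideanSpace ℝ (Fin 4)} (hz₀ : h z₀ ≠ 0) :
    0 < ∫ z, h z * (‖z - c‖ ^ 4)⁻¹ := by
  have hcs : HasCompactSupport h :=
    IsCompact.of_isClosed_subset (isCompact_closedBall _ _) (isClosed_tsupport _) hR
  have hmemR : ∀ z, h z ≠ 0 → ‖z - c‖ ≤ R := fun z hz => by
    have hz' : z ∈ closedBall c R := hR (subset_tsupport _ (mem_support.mpr hz))
    rwa [mem_closedBall, dist_eq_norm] at hz'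
  have hR0 : 0 < R := hℓ.trans_le ((hshell z₀ hz₀).trans (hmemR z₀ hz₀))
  have hint : 0 < ∫ z, h z := hc.integral_pos_of_hasCompactSupport_nonneg_nonzero hcs (fun z => h0 z) hz₀
  have hle : (R ^ 4)⁻¹ * ∫ z, h z ≤ ∫ z, h z * (‖z - c‖ ^ 4)⁻¹ := by
    rw [← integral_const_mul]
    refine integral_mono_of_nonneg (Filter.Eventually.of_forall fun z => ?_)
      (integrable_shellKernel hc hcs hℓ (fun z hz => by simpa using hshell z hz))
      (Filter.Eventually.of_forall fun z => ?_)
    · exact mul_nonneg (inv_nonneg.2 (pow_nonneg hR0.le 4)) (h0 z)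
    · by_cases hz : h z = 0
      · simp [hz]
      · have hz0 : 0 < ‖z - c‖ := hℓ.trans_le (hshell z hz)
        calc (R ^ 4)⁻¹ * h z = h z * (R ^ 4)⁻¹ := mul_comm _ _
          _ ≤ h z * (‖z - c‖ ^ 4)⁻¹ :=
            mul_le_mul_of_nonneg_left (inv_anti₀ (pow_pos hz0 4) (pow_le_pow_left₀ (norm_nonneg _) (hmemR z hz) 4)) (h0 z)
  exact lt_of_lt_of_le (mul_pos (inv_pos.2 (pow_pos hR0 4)) hint) hle

/-! ## 2. The one-loop OPE model factorises onto the mirror insertion -/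

/-- **Squeezed factorisation in the one-loop OPE model** (BC5 rung α for `SqueezedFactorisation`).  With the one-loop
scalar fusion kernel `-κ‖u‖⁻⁴` (`κ > 0` = the β₀-coefficient `(b₀/2π²)ḡ⁴(ℓ)`), a non-negative bump `v` of radius `ρ ≤ t·ℓ`
at `c`, a non-negative shell profile `h` supported in `ℓ ≤ ‖z - c‖`, and ANY non-negative continuous mirror insertion
`A`, the model three-point functional `T3 = ∫ v(x)·(-κ W(x))·A(x)` satisfies
`|T3 - (-1)·w·T2| ≤ δ(t)·w·T2`, `T2 = ∫ v·A`, `w = κ·W(c)`, `δ(t) = (1-t)⁻⁴ - (1+t)⁻⁴` — the crux's inequality with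
`σ = -1`, constants independent of `A` (no decay in the mirror distance). [cite: ZollerChetyrkin2012, eq. (20)] -/
theorem oneLoopModel_squeezedFactorisation {c : EuclideanSpace ℝ (Fin 4)}
    {v h : EuclideanSpace ℝ (Fin 4) → ℝ} (hvc : Continuous v) (hhc : Continuous h) (hhs : HasCompactSupport h)
    (hv0 : ∀ x, 0 ≤ v x) (hh0 : ∀ z, 0 ≤ h z)
    {ρ ℓ t κ : ℝ} (hℓ : 0 < ℓ) (ht0 : 0 ≤ t) (ht1 : t < 1) (hρt : ρ ≤ t * ℓ) (hκ : 0 < κ)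
    (hvsupp : tsupport v ⊆ closedBall c ρ) (hshell : ∀ z, h z ≠ 0 → ℓ ≤ ‖z - c‖)
    (A : EuclideanSpace ℝ (Fin 4) → ℝ) (hA : Continuous A) (hA0 : ∀ x, 0 ≤ A x) :
    |(∫ x, v x * (-κ * ∫ z, h z * (‖z - x‖ ^ 4)⁻¹) * A x)
        - (-1) * (κ * ∫ z, h z * (‖z - c‖ ^ 4)⁻¹) * ∫ x, v x * A x|
      ≤ (((1 - t) ^ 4)⁻¹ - ((1 + t) ^ 4)⁻¹) * (κ * ∫ z, h z * (‖z - c‖ ^ 4)⁻¹) * ∫ x, v x * A x := by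
  set W₀ : ℝ := ∫ z, h z * (‖z - c‖ ^ 4)⁻¹
  set lo : ℝ := ((1 + t) ^ 4)⁻¹
  set hi : ℝ := ((1 - t) ^ 4)⁻¹
  let W : EuclideanSpace ℝ (Fin 4) → ℝ := fun x => ∫ z, h z * (‖z - x‖ ^ 4)⁻¹
  change |(∫ x, v x * (-κ * W x) * A x) - (-1) * (κ * W₀) * ∫ x, v x * A x|
      ≤ (hi - lo) * (κ * W₀) * ∫ x, v x * A x
  have h1t : 0 < 1 - t := by linarith
  -- compact support and integrability of the two-point integrand `v·A`
  have hvs : HasCompactSupport v :=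
    IsCompact.of_isClosed_subset (isCompact_closedBall _ _) (isClosed_tsupport _) hvsupp
  have hvA : Integrable (fun x => v x * A x) :=
    (hvc.mul hA).integrable_of_hasCompactSupport (hvs.mul_right (f' := A))
  have hI : 0 ≤ ∫ x, v x * A x := integral_nonneg fun x => mul_nonneg (hv0 x) (hA0 x)
  have hW0 : 0 ≤ W₀ :=
    integral_nonneg fun z => mul_nonneg (hh0 z) (inv_nonneg.2 (pow_nonneg (norm_nonneg _) 4))
  have hlo1 : lo ≤ 1 := inv_le_one_of_one_le₀ (one_le_pow₀ (by linarith))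
  have hhi1 : 1 ≤ hi := one_le_inv_iff₀.2 ⟨pow_pos h1t 4, pow_le_one₀ h1t.le (by linarith)⟩
  -- the pinching on the support of `v`
  have hWx : ∀ x, v x ≠ 0 → lo * W₀ ≤ W x ∧ W x ≤ hi * W₀ := by
    intro x hx
    have hxB : x ∈ closedBall c ρ := hvsupp (subset_tsupport _ (mem_support.mpr hx))
    rw [mem_closedBall, dist_eq_norm] at hxB
    exact shellMoment_bounds hhc hhs hh0 hℓ ht0 ht1 hρt hshell hxB
  -- measurability of the smeared kernel `W` (a parametric integral of a jointly measurable function)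
  have hWm : StronglyMeasurable W := by
    refine StronglyMeasurable.integral_prod_right (f := fun x z => h z * (‖z - x‖ ^ 4)⁻¹) ?_
    exact ((hhc.measurable.comp measurable_snd).mul
      ((measurable_snd.sub measurable_fst).norm.pow_const 4).inv).stronglyMeasurable
  -- integrability of the three-point integrand
  have hJ : Integrable (fun x => v x * A x * W x) := by
    refine ((hvA.mul_const (hi * W₀))).mono' ((hvc.mul hA).aestronglyMeasurable.mul hWm.aestronglyMeasurable)
      (Filter.Eventually.of_forall fun x => ?_)
    by_cases hx : v x = 0
    · simp [hx]
    · obtain ⟨h1, h2⟩ := hWx x hx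
      have hWx0 : 0 ≤ W x := le_trans (mul_nonneg (inv_nonneg.2 (pow_nonneg (by linarith) 4)) hW0) h1
      rw [Real.norm_eq_abs, abs_of_nonneg (mul_nonneg (mul_nonneg (hv0 x) (hA0 x)) hWx0)]
      exact mul_le_mul_of_nonneg_left h2 (mul_nonneg (hv0 x) (hA0 x))
  -- the two-sided bound on `J = ∫ v·A·W`
  have hJhi : (∫ x, v x * A x * W x) ≤ (∫ x, v x * A x) * (hi * W₀) := by
    rw [← integral_mul_const]
    refine integral_mono hJ (hvA.mul_const _) fun x => ?_
    by_cases hx : v x = 0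
    · simp [hx]
    · exact mul_le_mul_of_nonneg_left (hWx x hx).2 (mul_nonneg (hv0 x) (hA0 x))
  have hJlo : (∫ x, v x * A x) * (lo * W₀) ≤ ∫ x, v x * A x * W x := by
    rw [← integral_mul_const]
    refine integral_mono (hvA.mul_const _) hJ fun x => ?_
    by_cases hx : v x = 0
    · simp [hx]
    · exact mul_le_mul_of_nonneg_left (hWx x hx).1 (mul_nonneg (hv0 x) (hA0 x))
  -- pull the constant out of the three-point functional
  have hT3 : (∫ x, v x * (-κ * W x) * A x) = -κ * ∫ x, v x * A x * W x := by
    rw [← integral_const_mul]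
    exact integral_congr_ae (Filter.Eventually.of_forall fun x => by ring)
  rw [hT3]
  have hfac : -κ * (∫ x, v x * A x * W x) - (-1) * (κ * W₀) * ∫ x, v x * A x
      = κ * (W₀ * (∫ x, v x * A x) - ∫ x, v x * A x * W x) := by ring
  rw [hfac, abs_mul, abs_of_pos hκ]
  have hcore : |W₀ * (∫ x, v x * A x) - ∫ x, v x * A x * W x| ≤ (hi - lo) * W₀ * ∫ x, v x * A x := by
    rw [abs_le]
    refine ⟨?_, ?_⟩
    · nlinarith [hJhi, hlo1, mul_nonneg hW0 hI]
    · nlinarith [hJlo, hhi1, mul_nonneg hW0 hI]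
  calc κ * |W₀ * (∫ x, v x * A x) - ∫ x, v x * A x * W x|
      ≤ κ * ((hi - lo) * W₀ * ∫ x, v x * A x) := mul_le_mul_of_nonneg_left hcore hκ.le
    _ = (hi - lo) * (κ * W₀) * ∫ x, v x * A x := by ring

/-- **The crux's literal shape, decided in the model.**  For a bump of radius `ρ ≤ ℓ/16` and a non-zero shell profile:
`∃ w δ σ, 0 < w ∧ δ < 1 ∧ (σ = 1 ∨ σ = -1) ∧ ∀ mirror insertions A ≥ 0, |T3 - σ·w·T2| ≤ δ·w·T2` — note the quantifier
over `A` INSIDE the existential: `w = κ·∫h‖z - c‖⁻⁴`, `δ = (16/15)⁴ - (16/17)⁴ ≈ 0.51`, `σ = -1` do not depend on the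
mirror (no decay in the mirror distance).  Compare `Theses.SqueezedSkewness.SqueezedFactorisation`, whose conclusion
this is with `Q3(v, θv, h) ↦ T3`, `Q2(θv, v) ↦ T2`. [folklore] -/
theorem oneLoopModel_cruxShape {c : EuclideanSpace ℝ (Fin 4)}
    {v h : EuclideanSpace ℝ (Fin 4) → ℝ} (hvc : Continuous v) (hhc : Continuous h) (hv0 : ∀ x, 0 ≤ v x) (hh0 : ∀ z, 0 ≤ h z)
    {ρ ℓ R κ : ℝ} (hℓ : 0 < ℓ) (hρ : ρ ≤ ℓ / 16) (hκ : 0 < κ)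
    (hvsupp : tsupport v ⊆ closedBall c ρ) (hshell : ∀ z, h z ≠ 0 → ℓ ≤ ‖z - c‖)
    (hR : tsupport h ⊆ closedBall c R) {z₀ : EuclideanSpace ℝ (Fin 4)} (hz₀ : h z₀ ≠ 0) :
    ∃ w δ σ : ℝ, 0 < w ∧ δ < 1 ∧ (σ = 1 ∨ σ = -1) ∧
      ∀ A : EuclideanSpace ℝ (Fin 4) → ℝ, Continuous A → (∀ x, 0 ≤ A x) →
        |(∫ x, v x * (-κ * ∫ z, h z * (‖z - x‖ ^ 4)⁻¹) * A x) - σ * w * ∫ x, v x * A x|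
          ≤ δ * w * ∫ x, v x * A x := by
  have hhs : HasCompactSupport h :=
    IsCompact.of_isClosed_subset (isCompact_closedBall _ _) (isClosed_tsupport _) hR
  have hW0pos := shellMoment_pos hhc hh0 hℓ hshell hR hz₀
  refine ⟨κ * ∫ z, h z * (‖z - c‖ ^ 4)⁻¹, ((1 - (1 / 16 : ℝ)) ^ 4)⁻¹ - ((1 + (1 / 16 : ℝ)) ^ 4)⁻¹, -1,
    mul_pos hκ hW0pos, by norm_num, Or.inr rfl, fun A hA hA0 => ?_⟩
  exact oneLoopModel_squeezedFactorisation hvc hhc hhs hv0 hh0 hℓ (by norm_num) (by norm_num)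
    (by linarith) hκ hvsupp hshell A hA hA0

/-- **Sign-definiteness (σ = -1 realised).**  In the model the squeezed three-point functional is NEGATIVE whenever the
mirror two-point insertion is non-trivial on the bump (`T2 > 0`): `T3 ≤ -(1 - δ)·w·T2 < 0`. [folklore] -/
theorem oneLoopModel_neg {c : EuclideanSpace ℝ (Fin 4)}
    {v h : EuclideanSpace ℝ (Fin 4) → ℝ} (hvc : Continuous v) (hhc : Continuous h) (hv0 : ∀ x, 0 ≤ v x) (hh0 : ∀ z, 0 ≤ h z)
    {ρ ℓ R κ : ℝ} (hℓ : 0 < ℓ) (hρ : ρ ≤ ℓ / 16) (hκ : 0 < κ)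
    (hvsupp : tsupport v ⊆ closedBall c ρ) (hshell : ∀ z, h z ≠ 0 → ℓ ≤ ‖z - c‖)
    (hR : tsupport h ⊆ closedBall c R) {z₀ : EuclideanSpace ℝ (Fin 4)} (hz₀ : h z₀ ≠ 0)
    (A : EuclideanSpace ℝ (Fin 4) → ℝ) (hA : Continuous A) (hA0 : ∀ x, 0 ≤ A x) (hT2 : 0 < ∫ x, v x * A x) :
    (∫ x, v x * (-κ * ∫ z, h z * (‖z - x‖ ^ 4)⁻¹) * A x) < 0 := by
  have hhs : HasCompactSupport h :=
    IsCompact.of_isClosed_subset (isCompact_closedBall _ _) (isClosed_tsupport _) hR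
  have hW0pos := shellMoment_pos hhc hh0 hℓ hshell hR hz₀
  have hmain := oneLoopModel_squeezedFactorisation hvc hhc hhs hv0 hh0 hℓ (by norm_num : (0 : ℝ) ≤ 1 / 16)
    (by norm_num : (1 / 16 : ℝ) < 1) (by linarith : ρ ≤ 1 / 16 * ℓ) hκ hvsupp hshell A hA hA0
  have hδ : ((1 - (1 / 16 : ℝ)) ^ 4)⁻¹ - ((1 + (1 / 16 : ℝ)) ^ 4)⁻¹ < 1 := by norm_num
  have hw : 0 < κ * ∫ z, h z * (‖z - c‖ ^ 4)⁻¹ := mul_pos hκ hW0pos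
  have hup := (abs_le.1 hmain).2
  nlinarith [mul_pos hw hT2]

/-! ## 3. The registered BC5 rung (closed form, registered as sub-goal `rung_oneLoopSqueeze` of stmt-QuantumFields-25917) -/

/-- **BC5 rung α of `SqueezedFactorisation`, closed form** (registered on the crux item as the named sub-goal
`rung_oneLoopSqueeze`; proved here by `oneLoopModel_cruxShape`).  It is NOT a stub of the composition
`SqueezedFactorisation_of` (birth skeleton `Cruxes/NT/Lines/squeezed_skewness_birth.lean`), and proves nothing about
lattice Yang–Mills. [folklore] -/
theorem rung_oneLoopSqueeze : ∀ (c : EuclideanSpace ℝ (Fin 4)) (v h : EuclideanSpace ℝ (Fin 4) → ℝ) (ρ ℓ R κ : ℝ) (z₀ : EuclideanSpace ℝ (Fin 4)), Continuous v → Continuous h → (∀ x, 0 ≤ v x) → (∀ z, 0 ≤ h z) → 0 < ℓ → ρ ≤ ℓ / 16 → 0 < κ → tsupport v ⊆ Metric.closedBall c ρ → (∀ z, h z ≠ 0 → ℓ ≤ ‖z - c‖) → tsupport h ⊆ Metric.closedBall c R → h z₀ ≠ 0 → ∃ w δ σ : ℝ, 0 < w ∧ δ < 1 ∧ (σ = 1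 ∨ σ = -1) ∧ ∀ A : EuclideanSpace ℝ (Fin 4) → ℝ, Continuous A → (∀ x, 0 ≤ A x) → |(∫ x, v x * (-κ * ∫ z, h z * (‖z - x‖ ^ 4)⁻¹) * A x) - σ * w * ∫ x, v x * A x| ≤ δ * w * ∫ x, v x * A x :=
  fun _c _v _h _ρ _ℓ _R _κ _z₀ hvc hhc hv0 hh0 hℓ hρ hκ hvs hsh hR hz₀ =>
    oneLoopModel_cruxShape hvc hhc hv0 hh0 hℓ hρ hκ hvs hsh hR hz₀

end Summit.QuantumFields.YangMills.Theorems.SqueezedSkewness
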